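import Literature.NumberTheory.Transcendental.PeriodConjecture
import Literature.NumberTheory.Transcendental.KZCalculusProofs
import Summits.KontsevichZagierPeriods.KontsevichZagierPeriods.Theorems.LiouvilleUnfoldingLogKernelConjectureStubReweighting
import Summits.KontsevichZagierPeriods.KontsevichZagierPeriods.Theorems.LiouvilleUnfoldingLogKernelConjectureStubGoodWeight
import Summits.KontsevichZagierPeriods.KontsevichZagierPeriods.Theorems.LiouvilleUnfoldingLogKernelConjectureStubIntervalUnit
import Summits.KontsevichZagierPeriods.KontsevichZagierPeriods.Theorems.LiouvilleUnfoldingLogKernelConjectureStubEngineAssembly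

/-!
# `LogKernelConjecture` (stmt-KontsevichZagierPeriods-2837) — line `spectator-localisation`,
stub `stub_split` (the TRANSFER: the spectator split is exact)

With the four engine stubs landed (`stub_reweighting`, `stub_goodWeight`, `stub_intervalUnit`,
`stub_engineAssembly`), FIBRED certificates of one-dimensional spectator products cancel
unconditionally (`stub_split_fibredSpectatorCancellation`). Consequently the kernel form of
Kontsevich–Zagier's Conjecture 1 (`Literature.NumberTheory.Transcendental.KZKernelConjecture`) is
EXACTLY the conjunction of the line's two open conjuncts, both phrased with one-dimensional spectators:

* `DarkTorsion₁` (list form): every formal combination of value `0` is annihilated modulo the four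
  moves by a finite product `[s₁]·([s₂]·(⋯ c))` of one-dimensional spectators of non-zero value — the
  weakest arithmetic core typed so far: it is implied by `KZKernelConjecture` (empty product) and by
  `KZ.PiLocalKernel` (`stub_split_darkTorsion_of_piLocalKernel`, replacing each disc `[π]` by the
  one-dimensional `[β(½,½)] ∼ [π]` of `BetaCancellationNegative.equivalent_betaHalfRep_piRep`);
* `SpectatorFibration₁`: a certificate for `[s]·c` (`s.value ≠ 0`) may be replaced, after changing
  `c` modulo relations, by a fibred one — equivalently (`stub_split_spectatorFibration_iff`) plain
  cancellation `[s]·c ∈ relations → c ∈ relations`.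

Forward direction: empty product, and `c' := 0` with soundness + multiplicativity of `eval`; backward:
peel the spectators one at a time — fibre the certificate, cancel with the engine. This is the transfer
step of the skeleton: the crux follows from the two conjuncts through `relations ≤ R` alone. [folklore]
-/

noncomputable section

open MeasureTheory Set
open Literature.NumberTheory.Transcendental

namespace Summit.KontsevichZagierPeriods.LiouvilleUnfolding.SpectatorLocalisation

/-- **The engine, assembled** (`FibredSpectatorCancellation₁`, unconditional): if a one-dimensional
spectator `s` has non-zero value and `[s]·c` is a FIBRED relation, then `c` is a relation
(`stub_engineAssembly` fed with `stub_reweighting`, `stub_goodWeight`, `stub_intervalUnit`). [folklore] -/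
theorem stub_split_fibredSpectatorCancellation : ∀ (s : Literature.NumberTheory.Transcendental.KZ.IntegralRep 1) (c : Literature.NumberTheory.Transcendental.KZ.FormalRep), s.value ≠ 0 → Literature.NumberTheory.Transcendental.KZ.of s * c ∈ Literature.NumberTheory.Transcendental.KZ.fibredRelations → c ∈ Literature.NumberTheory.Transcendental.KZ.relations :=
  stub_engineAssembly stub_reweighting stub_goodWeight stub_intervalUnit

/-- `SpectatorFibration₁` gives cancellation of one-dimensional spectators of non-zero value (fibre
the certificate, then cancel with the engine). [folklore] -/
theorem stub_split_cancellation_of_spectatorFibration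
    (hF : ∀ (s : Literature.NumberTheory.Transcendental.KZ.IntegralRep 1) (c : Literature.NumberTheory.Transcendental.KZ.FormalRep), s.value ≠ 0 → Literature.NumberTheory.Transcendental.KZ.of s * c ∈ Literature.NumberTheory.Transcendental.KZ.relations → ∃ c' : Literature.NumberTheory.Transcendental.KZ.FormalRep, c - c' ∈ Literature.NumberTheory.Transcendental.KZ.relations ∧ Literature.NumberTheory.Transcendental.KZ.of s * c' ∈ Literature.NumberTheory.Transcendental.KZ.fibredRelations) :
    ∀ (s : Literature.NumberTheory.Transcendental.KZ.IntegralRep 1) (c : Literature.NumberTheory.Transcendental.KZ.FormalRep), s.value ≠ 0 → Literature.NumberTheory.Transcendental.KZ.of s * c ∈ Literature.NumberTheory.Transcendental.KZ.relations → c ∈ Literature.NumberTheory.Transcendental.KZ.relations := by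
  intro s c hs h
  obtain ⟨c', hcc', hc'⟩ := hF s c hs h
  have h1 : c' ∈ KZ.relations := stub_split_fibredSpectatorCancellation s c' hs hc'
  have h2 := KZ.relations.add_mem hcc' h1
  simpa using h2

/-- `SpectatorFibration₁` is EXACTLY cancellation of one-dimensional spectators of non-zero value
(the witness `c'` may always be taken to be `0`). [folklore] -/
theorem stub_split_spectatorFibration_iff :
    (∀ (s : Literature.NumberTheory.Transcendental.KZ.IntegralRep 1) (c : Literature.NumberTheory.Transcendental.KZ.FormalRep), s.value ≠ 0 → Literature.NumberTheory.Transcendental.KZ.of s * c ∈ Literature.NumberTheory.Transcendental.KZ.relations → ∃ c' : Literature.NumberTheory.Transcendental.KZ.FormalRep, c - c' ∈ Literature.NumberTheory.Transcendental.KZ.relations ∧ Literature.NumberTheory.Transcendental.KZ.of s * c' ∈ Literature.NumberTheory.Transcendental.KZ.fibredRelations) ↔ ∀ (s : Literature.NumberTheory.Transcendental.KZ.IntegralRep 1) (c : Literature.NumberTheory.Transcendental.KZ.FormalRep), s.value ≠ 0 → Literature.NumberTheory.Transcendental.KZ.of s * c ∈ Literature.NumberTheory.Transcendental.KZ.relations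 → c ∈ Literature.NumberTheory.Transcendental.KZ.relations :=
  ⟨stub_split_cancellation_of_spectatorFibration,
    fun h s c hs hsc => ⟨0, by simpa using h s c hs hsc, by simp⟩⟩

/-- **Peeling**: under cancellation of good one-dimensional spectators, a formal combination killed by
a finite product of them is a relation (induction on the list). [folklore] -/
theorem stub_split_mem_relations_of_foldr (hC : ∀ (s : Literature.NumberTheory.Transcendental.KZ.IntegralRep 1) (c : Literature.NumberTheory.Transcendental.KZ.FormalRep), s.value ≠ 0 → Literature.NumberTheory.Transcendental.KZ.of s * c ∈ Literature.NumberTheory.Transcendental.KZ.relations → c ∈ Literature.NumberTheory.Transcendental.KZ.relations)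
    (c : KZ.FormalRep) : ∀ l : List (KZ.IntegralRep 1), (∀ s ∈ l, s.value ≠ 0) →
      List.foldr (fun s x => KZ.of s * x) c l ∈ KZ.relations → c ∈ KZ.relations
  | [], _, h => by simpa using h
  | s :: l, hl, h => by
    rw [List.foldr_cons] at h
    exact stub_split_mem_relations_of_foldr hC c l (fun t ht => hl t (List.mem_cons_of_mem s ht))
      (hC s _ (hl s List.mem_cons_self) h)

/-- **Position of the arithmetic conjunct**: `KZ.PiLocalKernel` (route AyoubSpecialisation, spectators
`[π]^N`) implies `DarkTorsion₁` in list form, given any one-dimensional representative `p ∼ [π]` of the disc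
(e.g. `[β(½,½)]`, `BetaCancellationNegative.equivalent_betaHalfRep_piRep`, or KZ's `[(-1,1), 2√(1−x²)]`,
`…equivalent_twoSqrtRep_piRep`; value `π ≠ 0` by soundness): replace each `[π]` by `p`, products
respect relations (`KZ.mul_sub_mul_mem_relations`). [folklore] -/
theorem stub_split_darkTorsion_of_piLocalKernel (p : KZ.IntegralRep 1)
    (hpπ : KZ.of p - KZ.of KZ.piRep ∈ KZ.relations) (h : KZ.PiLocalKernel) : ∀ c : Literature.NumberTheory.Transcendental.KZ.FormalRep, Literature.NumberTheory.Transcendental.KZ.eval c = 0 → ∃ l : List (Literature.NumberTheory.Transcendental.KZ.IntegralRep 1), (∀ s ∈ l, s.value ≠ 0) ∧ List.foldr (fun s x => Literature.NumberTheory.Transcendental.KZ.of s * x) c l ∈ Literature.NumberTheory.Transcendental.KZ.relations := by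
  intro c hc
  obtain ⟨N, hN⟩ := h c hc
  have hval : p.value ≠ 0 := by
    rw [KZ.Equivalent.value_eq_holds hpπ, KZ.piRep_value]
    exact Real.pi_ne_zero
  have key : ∀ M : ℕ, List.foldr (fun s x => KZ.of s * x) c (List.replicate M p) -
      (fun x => KZ.of KZ.piRep * x)^[M] c ∈ KZ.relations := by
    intro M
    induction M with
    | zero => simp [KZ.relations.zero_mem]
    | succ M ih =>
      rw [List.replicate_succ, List.foldr_cons, Function.iterate_succ_apply']
      exact KZ.mul_sub_mul_mem_relations hpπ ih
  refine ⟨List.replicate N p, fun s hs => ?_, ?_⟩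
  · rw [List.eq_of_mem_replicate hs]; exact hval
  · have := KZ.relations.add_mem (key N) hN
    simpa using this

/-- **Stub `stub_split` — the spectator split is exact.** The kernel form of Conjecture 1 is
equivalent to `DarkTorsion₁ ∧ SpectatorFibration₁` (one-dimensional spectators, list form): `→` with
the empty product and `c' := 0` (soundness `KZ.relations_le_ker_eval_holds`, `KZ.eval_mul'`); `←` by
`DarkTorsion₁`, then peeling with the cancellation supplied by `SpectatorFibration₁` and the landed
engine. [folklore] -/
theorem stub_split : Literature.NumberTheory.Transcendental.KZKernelConjecture ↔ ((∀ c : Literature.NumberTheory.Transcendental.KZ.FormalRep, Literature.NumberTheory.Transcendental.KZ.eval c = 0 → ∃ l : List (Literature.NumberTheory.Transcendental.KZ.IntegralRep 1), (∀ s ∈ l, s.value ≠ 0) ∧ List.foldr (fun s x => Literature.NumberTheory.Transcendental.KZ.of s * x) c l ∈ Literature.NumberTheory.Transcendental.KZ.relations) ∧ (∀ (s : Literature.NumberTheory.Transcendental.KZ.IntegralRep 1) (c : Literature.NumberTheory.Transcendental.KZ.FormalRep), s.value ≠ 0 → Literature.NumberTheory.Transcendental.KZ.of s * c ∈ Literature.NumberTheory.Transcendental.KZ.relations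 → ∃ c' : Literature.NumberTheory.Transcendental.KZ.FormalRep, c - c' ∈ Literature.NumberTheory.Transcendental.KZ.relations ∧ Literature.NumberTheory.Transcendental.KZ.of s * c' ∈ Literature.NumberTheory.Transcendental.KZ.fibredRelations)) := by
  constructor
  · intro h
    refine ⟨fun c hc => ⟨[], by simp, by simpa using h c hc⟩, fun s c hs hsc => ?_⟩
    refine ⟨0, ?_, by simp⟩
    have h0 : KZ.eval (KZ.of s * c) = 0 := KZ.relations_le_ker_eval_holds hsc
    rw [KZ.eval_mul', KZ.eval_of] at h0
    rcases mul_eq_zero.mp h0 with h1 | h1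
    · exact absurd h1 hs
    · simpa using h c h1
  · rintro ⟨hD, hF⟩ c hc
    obtain ⟨l, hl, h⟩ := hD c hc
    exact stub_split_mem_relations_of_foldr (stub_split_cancellation_of_spectatorFibration hF) c l hl h

end Summit.KontsevichZagierPeriods.LiouvilleUnfolding.SpectatorLocalisation
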